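import Summits.ResolutionOfSingularities.ResolutionOfSingularities.Theorems.HilbertSamuelEliminationCampaignW54SingInRidge

/-!
# [OURS · L1 W5.4 · kill test K5.4] `CampaignW54.SingInRidgeSchAt` holds for free where the cone is additive

Cell `res-hironaka`, LADDER-RESOLUTION rung L (rescue), kill test K5.4 of RESCUE-SEED slot W5.4, seat
`res-L1-k54` (PREREG `HOME/L/res-L1-k54/PREREG-K5.4.md`, sha16 `2d4c7c42680933af`; CAS job `j258977`);
host door `HilbertSamuelElimination` / informal crux `RidgeConfinement` (stmt-ResolutionOfSingularities-17845).
NOTHING here is a statement of H. Hironaka's manuscript (2017) and nothing here asserts that any statement of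
it holds or fails; the predicates are the cell's OURS campaign predicates of
`…Theorems.HilbertSamuelEliminationCampaignW54SingInRidge` (typer o5, p462619).

## What is proved (the CALIBRATION row of K5.4: reading (W_T) «holds, forced by C₀X = F₀»)

For an ideal exponent `E = (J, b)` with `b > 0` on a locally noetherian scheme `Z` and any point `ξ`:

* `sing_subset_support`, `le_vanishingIdeal_singClosure` — `Sing(E) ⊆ V(J)`, hence `J ≤ I(Sing(E)_red)`
  (Mathlib's Galois connection `support ⊣ vanishingIdeal`).
* `coneIdealAt_le_singConeIdealAt` — ALWAYS `cl_b(J_ξ)·k[X] ≤ In_𝔪(I(Sing E)_ξ)`: the tangent cone of the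
  reduced singular locus lies in the cone of the pair, scheme-theoretically, for free (the typer's
  VACUITY-ADDENDUM 2026-08-26T19:16:20Z, here in the kernel).
* `singInRidgeSchAt_of_span_additive` — if the cone ideal of the pair at `ξ` is spanned by ADDITIVE forms
  (the cone is its own Giraud ridge, tree `Resolution.ridgeIdeal_span_eq`), then the scheme-theoretic campaign
  predicate `SingInRidgeSchAt E ξ` (R2) holds, hence the set-theoretic `SingInRidgeAt E ξ` (R1,
  `singInRidgeAt_of_span_additive`).
* `singInRidgeSchAt_of_cone_eq_span_linear_pow` / `…_char` — in particular at every point where the cone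
  ideal is `⟨ℓ̄^q⟩`, `ℓ̄` a linear form, `q` a power of the (exponential) characteristic: the purely
  inseparable («wild») hypersurface points `in_ξ f = ℓ̄^{p^e}`. Both W-Q origins are such points
  (`in₀ f = x̄²` at `p = 2` in `𝔸⁵`, `in₀ f = x̄³` at `p = 3` in `𝔸⁴`; job `j258977` row Q1), so the typed
  campaign statement is satisfied there for a reason that carries no enclosure-with-descent content — while
  every reading with descent value fails there (companion file `…RidgeConfinementK54ThickRidge`: no thick
  ridge `V(ℓ^q)` through the origin contains the W-Q curve, `edim₀ γ = n`).

References (orientation only): J. Giraud, Ann. Sci. ÉNS 8 (1975) §1.5–1.6; V. Cossart, U. Jannsen, S. Saito,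
LNM 2270 (2020) §2.2, Thm 3.2; B. Schober, J. Algebra 565 (2021) Def. 2.4–2.5.
-/

noncomputable section

set_option linter.dupNamespace false -- mandated namespace of this single-conjunct summit

open _root_.AlgebraicGeometry _root_.TopologicalSpace IsLocalRing
open Literature.AlgebraicGeometry.Resolution Literature.RingTheory.HilbertSamuel
open Literature.AlgebraicGeometry.Hironaka2017.S02Preliminaries
open _root_.AlgebraicGeometry.Scheme.IdealSheafData

namespace Summit.ResolutionOfSingularities.ResolutionOfSingularities.Theorems

universe u

namespace CampaignW54

variable {Z : Scheme.{u}} [IsLocallyNoetherian Z]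

omit [IsLocallyNoetherian Z] in
/-- `Sing(E) ⊆ V(J)` for `b ≥ 1`: a point where `ord_ξ J ≥ b ≥ 1` lies in the support of `J`. [folklore] -/
theorem sing_subset_support (E : IdealExponent Z) (hb : 0 < E.b) :
    E.sing ⊆ (E.J.support : Set Z) := by
  intro ξ hξ
  have h1 : (1 : ℕ∞) ≤ (E.b : ℕ∞) := by exact_mod_cast hb
  exact (one_le_idealOrder_iff E.J ξ).mp (h1.trans hξ)

omit [IsLocallyNoetherian Z] in
/-- The closure of `Sing(E)` lies in the (closed) support of `J`. [folklore] -/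
theorem singClosure_le_support (E : IdealExponent Z) (hb : 0 < E.b) :
    singClosure E ≤ E.J.support := by
  change closure E.sing ⊆ (E.J.support : Set Z)
  exact closure_minimal (sing_subset_support E hb) E.J.support.isClosed

omit [IsLocallyNoetherian Z] in
/-- **`J ≤ I(Sing(E)_red)`**: the ideal of the pair vanishes on the (closure of the) singular locus
(Mathlib's Galois connection between `support` and `vanishingIdeal`). [folklore] -/
theorem le_vanishingIdeal_singClosure (E : IdealExponent Z) (hb : 0 < E.b) :
    E.J ≤ vanishingIdeal (singClosure E) :=
  le_support_iff_le_vanishingIdeal.mp (singClosure_le_support E hb)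

/-- **The cone of the reduced singular locus lies in the cone of the pair, for free**:
`cl_b(J_ξ)·k[X] ≤ In_𝔪(I(Sing E)_ξ)` — every degree-`b` initial form of an element of `J_ξ` is an initial form
of an element of the (larger) stalk of the vanishing ideal of `Sing(E)`. [folklore] -/
theorem coneIdealAt_le_singConeIdealAt (E : IdealExponent Z) (hb : 0 < E.b) (ξ : Z) :
    coneIdealAt E ξ ≤ singConeIdealAt E ξ := by
  refine Ideal.span_le.mpr fun G hG => ?_
  have hle : stalkIdeal E.J ξ ≤ stalkIdeal (vanishingIdeal (singClosure E)) ξ :=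
    stalkIdeal_mono (le_vanishingIdeal_singClosure E hb) ξ
  exact initialForms_le_initialIdeal (minGenerators (Z.presheaf.stalk ξ)) _ E.b
    (initialForms_mono (minGenerators (Z.presheaf.stalk ξ)) hle E.b hG)

/-- **R2 for free where the cone is its own ridge.** If the tangent cone ideal of the pair at `ξ` is
spanned by a set `G` of ADDITIVE forms (so that Giraud's ridge of the cone is the cone itself,
`Resolution.ridgeIdeal_span_eq`), then `SingInRidgeSchAt E ξ`. [folklore] -/
theorem singInRidgeSchAt_of_span_additive (E : IdealExponent Z) (hb : 0 < E.b) (ξ : Z)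
    {G : Set (MvPolynomial (Fin (maximalIdeal (Z.presheaf.stalk ξ)).spanFinrank)
      (ResidueField (Z.presheaf.stalk ξ)))}
    (hG : ∀ g ∈ G, IsAdditive g) (hcone : coneIdealAt E ξ = Ideal.span G) :
    SingInRidgeSchAt E ξ := by
  unfold SingInRidgeSchAt ridgeIdealAt
  rw [hcone, ridgeIdeal_span_eq hG, ← hcone]
  exact coneIdealAt_le_singConeIdealAt E hb ξ

/-- R1 (the typed default reading, set-theoretic) under the same hypothesis. [folklore] -/
theorem singInRidgeAt_of_span_additive (E : IdealExponent Z) (hb : 0 < E.b) (ξ : Z)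
    {G : Set (MvPolynomial (Fin (maximalIdeal (Z.presheaf.stalk ξ)).spanFinrank)
      (ResidueField (Z.presheaf.stalk ξ)))}
    (hG : ∀ g ∈ G, IsAdditive g) (hcone : coneIdealAt E ξ = Ideal.span G) :
    SingInRidgeAt E ξ :=
  singInRidgeAt_of_sch (singInRidgeSchAt_of_span_additive E hb ξ hG hcone)

/-- **The wild hypersurface point.** If the cone ideal of the pair at `ξ` is `⟨ℓ̄^q⟩` with `ℓ̄` a linear form
and `q = (exp. char k(ξ))^e` — the purely inseparable initial form `in_ξ f = ℓ̄^{p^e}`, e.g. `x̄²` (`p = 2`,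
W-Q origin of `𝔸⁵`) or `x̄³` (`p = 3`, W-Q origin of `𝔸⁴`) — then `SingInRidgeSchAt E ξ` holds. [folklore] -/
theorem singInRidgeSchAt_of_cone_eq_span_linear_pow (E : IdealExponent Z) (hb : 0 < E.b) (ξ : Z)
    (ℓ : MvPolynomial (Fin (maximalIdeal (Z.presheaf.stalk ξ)).spanFinrank)
      (ResidueField (Z.presheaf.stalk ξ))) (hℓ : ℓ.IsHomogeneous 1) (e : ℕ)
    (hcone : coneIdealAt E ξ =
      Ideal.span {ℓ ^ ringExpChar (ResidueField (Z.presheaf.stalk ξ)) ^ e}) :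
    SingInRidgeSchAt E ξ :=
  singInRidgeSchAt_of_span_additive E hb ξ (fun g hg => by
    rw [Set.mem_singleton_iff] at hg
    rw [hg]
    exact (isAdditive_of_isHomogeneous_one hℓ).pow e) hcone

/-- The same in terms of the prime characteristic `p` of the residue field: cone ideal `⟨ℓ̄^p⟩`
(`in_ξ f = ℓ̄^p`, the shape at both W-Q origins) ⇒ `SingInRidgeSchAt E ξ` and `SingInRidgeAt E ξ`. [folklore] -/
theorem singInRidgeSchAt_of_cone_eq_span_linear_pow_char (E : IdealExponent Z) (hb : 0 < E.b) (ξ : Z)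
    (p : ℕ) [Fact p.Prime] [CharP (ResidueField (Z.presheaf.stalk ξ)) p]
    (ℓ : MvPolynomial (Fin (maximalIdeal (Z.presheaf.stalk ξ)).spanFinrank)
      (ResidueField (Z.presheaf.stalk ξ))) (hℓ : ℓ.IsHomogeneous 1)
    (hcone : coneIdealAt E ξ = Ideal.span {ℓ ^ p}) :
    SingInRidgeSchAt E ξ ∧ SingInRidgeAt E ξ := by
  have h1 : coneIdealAt E ξ =
      Ideal.span {ℓ ^ ringExpChar (ResidueField (Z.presheaf.stalk ξ)) ^ 1} := by
    rw [pow_one, ringExpChar.eq (ResidueField (Z.presheaf.stalk ξ)) p]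
    exact hcone
  have h := singInRidgeSchAt_of_cone_eq_span_linear_pow E hb ξ ℓ hℓ 1 h1
  exact ⟨h, singInRidgeAt_of_sch h⟩

end CampaignW54

end Summit.ResolutionOfSingularities.ResolutionOfSingularities.Theorems

end
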